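import Summits.HodgeConjecture.HodgeConjecture.Theorems.A3Liu418S34ClauseOneOfGS
import Summits.HodgeConjecture.CorCM.HermSpaceTransport
import Literature.AlgebraicGeometry.ShimuraVarieties.UnitaryAnisotropicLineFrame
import Literature.AlgebraicGeometry.ShimuraVarieties.UnitaryBallSpecialCurveDatumOfCode
import HarnessLib

/-!
# GS-6 hoist (β), frame choice: a rational diagonal frame of the rescaled curve block `a′⁻¹·J⋆` of a `frobeniusActsByGS` frame, print-shaped

Cell `hodgecm-mathlib` (D-0151), the `hLiu418` cone, row III-14 GS-6: the (β) road replaces the face-level named fact `frobeniusActsByGS`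
([Liu2021, Thm. D.6 (1) + Rem. D.5] at the GS curve inside the rank-3 face) by the CURVE-ONLY named fact `thmD6OneCurveCUF`
([Liu2021, Thm. D.6 (1)] for one unitary Shimura curve, A-plan2 SPEC `A-plan/GS6-HOIST-SPEC.md` §9.10) plus PROVED see-saw glue.
This file is placement row S-1 (director hodgecm-mathlib g8 RULING s127, 2026-08-29T10:29Z): the FRAME-CHOICE socket of the glue's
`DecompositionAtFace`.

For a frame `ᵗ(cB)·(a′·H_V)·B = J⋆ ⊕ᶠ J⊥` (`hB`, `a′ ≠ 0`, `0 < ι₁(a′)` real, `0 < Re ι₁(J⊥₀₀)`, `4 ≤ [F:ℚ]`) the rescaled curve block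
`a′⁻¹·J⋆` (a sub-form of `H_V` in the frame `B`) admits a rational diagonalising congruence `gstar ∈ GL₂(F)` with REAL (`c`-fixed)
non-zero diagonal `dJ`, and `diagonal dJ` has signature `(1,1)` at `ι₁` and is positive definite at every other complex place — the
binders `(gstar, dJ, hdJ, hdJ0, hg, hsig)` at which the curve fact is instantiated.

* §1 the rescaled frame: `gsFrame_hB_rescaled` (`ᵗ(cB)·H_V·B = (a′⁻¹·J⋆) ⊕ᶠ (a′⁻¹·J⊥)`), `gsFrame_posDef_rescaled` (positive definite
  off `ι₁` for EVERY sign pattern of `a′`: ★ `gsFace_posDef`), `gsFrame_frame_rescaled` (signature `(1,1)` at `ι₁`, given `0 < Re ι₁(J⊥₀₀)`: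
  ★ `exists_frame_map_subform_left_eq_diagonal_one`);
* §2 plumbing: `finSum 1 1` of `1 × 1` blocks is diagonal; congruences compose; complex congruence is `Tᴴ·A·T`;
* §3 `gsFrame_det_subformLeft_ne_zero` and the socket `gsFrame_exists_diagFrame`: anisotropy of `a′⁻¹·J⋆` (★ `gsFace_anisotropic`,
  `4 ≤ [F:ℚ]`) makes `e₁` non-isotropic, ★ `exists_frame_formCongr_eq_finSum_of_isHermitian (n := 1)` splits off `⟨e₁⟩`, the
  diagonal is `c`-fixed (★ `isHermitian_subform_left/right`) and non-zero (★ `det_formCongr`), and §1 moves along `gstar` by ★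
  `formCongr_map`, composition of congruences and `Matrix.PosDef.conjTranspose_mul_mul_same`.

Theorems only (no definition, no named fact, no `sorry`).  HC_CM is proved only modulo the 7 printed citations until rung 0 closes; this
file changes no count (GS-6 hoist is count-neutral, s127).

## References
* [Liu2021] Y. Liu, *Fourier–Jacobi cycles and arithmetic relative trace formula*, Camb. J. Math. 9 (2021) = arXiv:2102.11518: Thm. 4.15
  proof (FJcycle.tex l. 2193–2199, the sub-space `V = V⋆ ⊕ V⋆^⊥`); App. D §D.3 l. 5355 (signature `(1,1)` at `τ₁`, `(2,0)` elsewhere).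
* [BergeronMillsonMoeglin2016Balls] N. Bergeron, J. Millson, C. Moeglin, *Hodge type theorems for arithmetic manifolds associated to
  orthogonal groups* / ball quotients, Part 2 §§1.1, 1.3, 3.1 (hermitian forms, negative cones, sub-forms).
* [Kudla1984] S. Kudla, *Seesaw dual reductive pairs*, §1.
* [HornJohnson2013] R. Horn, C. Johnson, *Matrix Analysis* (2nd ed.), §4.5 Thm 4.5.8 (Sylvester's law of inertia).
* [Dieudonne1971GroupesClassiques] J. Dieudonné, *La géométrie des groupes classiques*, Chap. II §5.
-/

set_option autoImplicit false

noncomputable section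

namespace Summit.HodgeConjecture.CorCM.Lines.A3Liu418

open NumberField Matrix
open scoped Matrix ComplexOrder
open Literature.AlgebraicGeometry.ShimuraVarieties (exists_frame_formCongr_eq_finSum_of_isHermitian formCongr_smul smul_finSum)
open Literature.NumberTheory.Automorphic Literature.NumberTheory.Automorphic.UnitaryGroup
open Summit.HodgeConjecture.CorCM.Model Summit.HodgeConjecture.CorCM.Model.HComp Summit.HodgeConjecture.CorCM.HComp

/-! ## §1 The rescaled frame `a′⁻¹·J⋆` -/

section GSFrameRescaled

variable {F : CMField} {ι₁ : F →+* ℂ} (V : HermSpace3 F ι₁)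
  (Jstar : Matrix (Fin 2) (Fin 2) F) (Jperp : Matrix (Fin 1) (Fin 1) F) (B : GL (Fin 3) F) {a' : F} (ha : a' ≠ 0)
  (hB : formCongr ((IsCMField.complexConj F : F ≃ₐ[↥(maximalRealSubfield F)] F) : F →+* F) B (a' • V.Hm) =
    finSum 2 1 Jstar Jperp)

include ha hB in
/-- **The rescaled frame equation**: `ᵗ(cB)·((1 : F)·H_V)·B = (a′⁻¹·J⋆) ⊕ᶠ (a′⁻¹·J⊥)`. [cite: BergeronMillsonMoeglin2016Balls, Part 2 §3.1] -/
theorem gsFrame_hB_rescaled :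
    formCongr ((IsCMField.complexConj F : F ≃ₐ[↥(maximalRealSubfield F)] F) : F →+* F) B ((1 : F) • V.Hm) =
      finSum 2 1 (a'⁻¹ • Jstar) (a'⁻¹ • Jperp) := by
  rw [one_smul, ← smul_finSum, ← hB, formCongr_smul, smul_smul, inv_mul_cancel₀ ha, one_smul]

include ha hB in
/-- **`a′⁻¹·J⋆` is positive definite off the place of `ι₁`**, for every sign pattern of `a′` (★ `gsFace_posDef` at the rescaled
frame). [cite: Kudla1984, §1] -/
theorem gsFrame_posDef_rescaled :
    ∀ τ' : F →+* ℂ, InfinitePlace.mk τ' ≠ InfinitePlace.mk ι₁ → ((a'⁻¹ • Jstar).map τ').PosDef :=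
  gsFace_posDef V (a'⁻¹ • Jstar) (a'⁻¹ • Jperp) B (gsFrame_hB_rescaled V Jstar Jperp B ha hB)

include ha hB in
/-- **Signature `(1,1)` at `ι₁` of `a′⁻¹·J⋆`**, granted `0 < ι₁(a′)` real and `0 < Re ι₁(J⊥₀₀)` (★
`exists_frame_map_subform_left_eq_diagonal_one` at the rescaled frame). [cite: HornJohnson2013, §4.5 Thm 4.5.8] -/
theorem gsFrame_frame_rescaled (hτa : 0 < (ι₁ a').re) (hτa' : (ι₁ a').im = 0) (hpos : 0 < (ι₁ (Jperp 0 0)).re) :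
    ∃ Tstar : GL (Fin 2) ℂ, formCongr (starRingEnd ℂ) Tstar ((a'⁻¹ • Jstar).map ι₁) = Matrix.diagonal ![1, -1] := by
  have hpos' : 0 < (ι₁ ((a'⁻¹ • Jperp) 0 0)).re := by
    have hre : ι₁ a' = ((ι₁ a').re : ℂ) := Complex.ext rfl (by rw [Complex.ofReal_im]; exact hτa')
    rw [Matrix.smul_apply, smul_eq_mul, map_mul, map_inv₀, hre, ← Complex.ofReal_inv, Complex.re_ofReal_mul]
    exact mul_pos (inv_pos.mpr hτa) hpos
  exact exists_frame_map_subform_left_eq_diagonal_one (cmConjRingHom F) ι₁ (IsCMField.complexConj_apply_apply (K := F))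
    (embedding_cmConjRingHom F ι₁) (gsFace_transpose_map_Hm V) (formCongr_frameOf V)
    (gsFace_hB_cm V (a'⁻¹ • Jstar) (a'⁻¹ • Jperp) B (gsFrame_hB_rescaled V Jstar Jperp B ha hB)) hpos'

end GSFrameRescaled

/-! ## §2 Plumbing: `1 × 1` direct sums, composition of congruences, complex congruence as `Tᴴ·A·T` -/

section Plumbing

variable {R : Type*} [CommRing R]

/-- `!![x] ⊕ᶠ… : finSum 1 1 J₁ !![x] = diagonal (J₁ 0 0, x)`. [folklore] -/
theorem finSum_one_one_eq_diagonal (J₁ : Matrix (Fin 1) (Fin 1) R) (x : R) :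
    finSum 1 1 J₁ !![x] = Matrix.diagonal ![J₁ 0 0, x] := by
  ext i j
  fin_cases i <;> fin_cases j
  · exact Literature.AlgebraicGeometry.ShimuraVarieties.finSum_one_apply_castSucc_castSucc J₁ !![x] 0 0
  · exact Literature.AlgebraicGeometry.ShimuraVarieties.finSum_one_apply_castSucc_last J₁ !![x] 0
  · exact Literature.AlgebraicGeometry.ShimuraVarieties.finSum_one_apply_last_castSucc J₁ !![x] 0
  · exact Literature.AlgebraicGeometry.ShimuraVarieties.finSum_one_apply_last_last J₁ !![x]

/-- Congruence composes: `ᵗσ(ST)·H·(ST) = ᵗσ(T)·(ᵗσ(S)·H·S)·T`. [folklore] -/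
theorem formCongr_mul_eq {n : Type*} [Fintype n] [DecidableEq n] (σ : R →+* R) (S T : GL n R) (H : Matrix n n R) :
    formCongr σ (S * T) H = formCongr σ T (formCongr σ S H) := by
  simp only [formCongr, Units.val_mul, Matrix.map_mul, Matrix.transpose_mul, Matrix.mul_assoc]

/-- Complex congruence is `Tᴴ·A·T` (`rfl`, as ★ `conjTranspose_mul_mul_eq_formCongr'`). [folklore] -/
theorem formCongr_starRingEnd_eq {n : Type*} [Fintype n] [DecidableEq n] (T : GL n ℂ) (A : Matrix n n ℂ) :
    formCongr (starRingEnd ℂ) T A = (T : Matrix n n ℂ)ᴴ * A * (T : Matrix n n ℂ) := rfl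

end Plumbing

/-! ## §3 The frame-choice socket -/

section FrameChoice

variable {F : CMField} {ι₁ : F →+* ℂ} (V : HermSpace3 F ι₁)
  (Jstar : Matrix (Fin 2) (Fin 2) F) (Jperp : Matrix (Fin 1) (Fin 1) F) (B : GL (Fin 3) F) {a' : F} (ha : a' ≠ 0)
  (hB : formCongr ((IsCMField.complexConj F : F ≃ₐ[↥(maximalRealSubfield F)] F) : F →+* F) B (a' • V.Hm) =
    finSum 2 1 Jstar Jperp)

include ha hB in
/-- `det J⋆ ≠ 0`: `det (J⋆ ⊕ᶠ J⊥) = c(det B)·det (a′·H_V)·det B ≠ 0` (★ `det_formCongr`, ★ `HermSpace3.det_ne_zero`).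
[cite: Dieudonne1971GroupesClassiques, Chap. II §5] -/
theorem gsFrame_det_subformLeft_ne_zero : Jstar.det ≠ 0 := by
  have hdet : (finSum 2 1 Jstar Jperp).det ≠ 0 := by
    rw [← hB, det_formCongr, Matrix.det_smul, Fintype.card_fin]
    refine mul_ne_zero (mul_ne_zero ?_ (mul_ne_zero (pow_ne_zero _ ha) (HermSpace3.det_ne_zero V))) ?_
    · exact (map_ne_zero _).2 (Matrix.GeneralLinearGroup.det_ne_zero B)
    · exact Matrix.GeneralLinearGroup.det_ne_zero B
  intro h0
  apply hdet
  rw [det_finSum, h0, zero_mul]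

include ha hB in
/-- **The frame-choice socket of `DecompositionAtFace`**: a rational congruence `gstar` diagonalising the rescaled curve block
`a′⁻¹·J⋆` with a REAL (`c`-fixed), non-zero diagonal `dJ`, the frame equation, and the print-shaped signature of `diagonal dJ`
(`(1,1)` at `ι₁` given `0 < Re ι₁(J⊥₀₀)`, positive definite at every other complex place).
[cite: BergeronMillsonMoeglin2016Balls, Part 2 §§1.1, 3.1] [cite: HornJohnson2013, §4.5 Thm 4.5.8] [cite: Liu2021, App. D l. 5355] -/
theorem gsFrame_exists_diagFrame (hτa : 0 < (ι₁ a').re) (hτa' : (ι₁ a').im = 0) (hpos : 0 < (ι₁ (Jperp 0 0)).re)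
    (h4 : 4 ≤ Module.finrank ℚ F) :
    ∃ (gstar : GL (Fin 2) F) (dJ : Fin 2 → F)
      (_ : ∀ i, ((IsCMField.complexConj F : F ≃ₐ[↥(maximalRealSubfield F)] F) : F →+* F) (dJ i) = dJ i) (_ : ∀ i, dJ i ≠ 0),
      formCongr ((IsCMField.complexConj F : F ≃ₐ[↥(maximalRealSubfield F)] F) : F →+* F) gstar (a'⁻¹ • Jstar) =
          Matrix.diagonal dJ ∧
        (∃ Tstar : GL (Fin 2) ℂ, formCongr (starRingEnd ℂ) Tstar ((Matrix.diagonal dJ).map ι₁) = Matrix.diagonal ![1, -1]) ∧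
        ∀ τ' : F →+* ℂ, InfinitePlace.mk τ' ≠ InfinitePlace.mk ι₁ → ((Matrix.diagonal dJ).map τ').PosDef := by
  -- the rescaled frame in the `cmConjRingHom` spelling, hermitian-ness and anisotropy of `H′ := a′⁻¹·J⋆`
  have hB' := gsFrame_hB_rescaled V Jstar Jperp B ha hB
  have hBc' := gsFace_hB_cm V (a'⁻¹ • Jstar) (a'⁻¹ • Jperp) B hB'
  have hσ : ∀ x, cmConjRingHom F (cmConjRingHom F x) = x := IsCMField.complexConj_apply_apply (K := F)
  have hH' : ((a'⁻¹ • Jstar).map (cmConjRingHom F))ᵀ = a'⁻¹ • Jstar :=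
    isHermitian_subform_left (N₁ := 2) (N₂ := 1) (cmConjRingHom F) hσ (gsFace_transpose_map_Hm V) (map_one _) hBc'
  have hanis := gsFace_anisotropic V h4 (a'⁻¹ • Jstar) (a'⁻¹ • Jperp) B hB'
  -- the first basis vector is non-isotropic
  set w : Fin 2 → F := Pi.single 0 1 with hw_def
  have hw : Literature.AlgebraicGeometry.ShimuraVarieties.hermForm (cmConjRingHom F) (a'⁻¹ • Jstar) w w ≠ 0 := by
    intro h0
    have h := congrFun (hanis w h0) 0
    rw [hw_def, Pi.single_eq_same] at h
    exact one_ne_zero h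
  -- split off the line `⟨w⟩`
  obtain ⟨J₁, gstar, hg, -, -, -⟩ :=
    exists_frame_formCongr_eq_finSum_of_isHermitian (cmConjRingHom F) (n := 1) (a'⁻¹ • Jstar) hσ hH' w hw
  set x : F := Literature.AlgebraicGeometry.ShimuraVarieties.hermForm (cmConjRingHom F) (a'⁻¹ • Jstar) w w with hx_def
  have hgd : formCongr (cmConjRingHom F) gstar (a'⁻¹ • Jstar) = Matrix.diagonal ![J₁ 0 0, x] := by
    rw [hg, finSum_one_one_eq_diagonal]
  -- the diagonal is `c`-fixed
  have hg1 : formCongr (cmConjRingHom F) gstar ((1 : F) • (a'⁻¹ • Jstar)) = finSum 1 1 J₁ !![x] := by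
    rw [one_smul]; exact hg
  have hJ₁ : (J₁.map (cmConjRingHom F))ᵀ = J₁ :=
    isHermitian_subform_left (N₁ := 1) (N₂ := 1) (cmConjRingHom F) hσ hH' (map_one _) hg1
  have hX : ((!![x] : Matrix (Fin 1) (Fin 1) F).map (cmConjRingHom F))ᵀ = !![x] :=
    isHermitian_subform_right (N₁ := 1) (N₂ := 1) (cmConjRingHom F) hσ hH' (map_one _) hg1
  have hdJc : ∀ i, cmConjRingHom F (![J₁ 0 0, x] i) = ![J₁ 0 0, x] i := by
    intro i
    fin_cases i
    · have h := congrFun (congrFun hJ₁ 0) 0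
      rwa [transpose_apply, map_apply] at h
    · have h := congrFun (congrFun hX 0) 0
      rw [transpose_apply, map_apply] at h
      exact h
  -- the diagonal is non-zero (determinants)
  have hdet : (J₁ 0 0) * x ≠ 0 := by
    have h := congrArg Matrix.det hgd
    rw [det_formCongr, Matrix.det_diagonal, Fin.prod_univ_two] at h
    simp only [Matrix.cons_val_zero, Matrix.cons_val_one] at h
    rw [← h, Matrix.det_smul, Fintype.card_fin]
    refine mul_ne_zero (mul_ne_zero ?_ (mul_ne_zero (pow_ne_zero _ (inv_ne_zero ha))
      (gsFrame_det_subformLeft_ne_zero V Jstar Jperp B ha hB))) ?_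
    · exact (map_ne_zero _).2 (Matrix.GeneralLinearGroup.det_ne_zero gstar)
    · exact Matrix.GeneralLinearGroup.det_ne_zero gstar
  have hdJ0 : ∀ i, ![J₁ 0 0, x] i ≠ 0 := by
    intro i
    fin_cases i
    · exact left_ne_zero_of_mul hdet
    · exact right_ne_zero_of_mul hdet
  -- the frame equation in the coerced spelling
  have hgd' : formCongr ((IsCMField.complexConj F : F ≃ₐ[↥(maximalRealSubfield F)] F) : F →+* F) gstar (a'⁻¹ • Jstar) =
      Matrix.diagonal ![J₁ 0 0, x] := by
    rw [coe_complexConj_eq_conjRingHomK' F]; exact hgd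
  refine ⟨gstar, ![J₁ 0 0, x], fun i => by rw [coe_complexConj_eq_conjRingHomK' F]; exact hdJc i, hdJ0, hgd', ?_, ?_⟩
  · -- signature (1,1) at `ι₁`: the rescaled frame `Tstar` composed with `(gstar^{ι₁})⁻¹`
    obtain ⟨Tstar, hT⟩ := gsFrame_frame_rescaled V Jstar Jperp B ha hB hτa hτa' hpos
    refine ⟨(Matrix.GeneralLinearGroup.map ι₁ gstar)⁻¹ * Tstar, ?_⟩
    rw [← hgd, formCongr_map (cmConjRingHom F) ι₁ (embedding_cmConjRingHom F ι₁) gstar (a'⁻¹ • Jstar), ← formCongr_mul_eq,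
      mul_inv_cancel_left, hT]
  · -- positive definite off `ι₁`: congruence by `gstar^{τ′}`
    intro τ' hτ'
    rw [← hgd, formCongr_map (cmConjRingHom F) τ' (embedding_cmConjRingHom F τ') gstar (a'⁻¹ • Jstar), formCongr_starRingEnd_eq]
    exact (gsFrame_posDef_rescaled V Jstar Jperp B ha hB τ' hτ').conjTranspose_mul_mul_same
      (Matrix.mulVec_injective_iff_isUnit.2 ⟨Matrix.GeneralLinearGroup.map τ' gstar, rfl⟩)

end FrameChoice

end Summit.HodgeConjecture.CorCM.Lines.A3Liu418

end
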